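import Summits.AtomisticToContinuum.Crystallization.Theorems.FrustratedLawDichotomyStrainedPatchHomEntryFlipHcp

/-!
# SYMMETRY REDUCTION of the hcp half of `(H)`, part 3 (kit): the VERTICAL MIRROR `S` with normal `h₁ = (1/2, √3/2, 0)` — the third generator of the
# A-site group `D₃ₕ` of ideal hcp — relabelling, tail, and the transfer of the hcp dichotomy

decomp-a2c hand-2 g29 (crux `AperiodicFrustratedLawGap`, stmt-AtomisticToContinuum-27623; sequel of hand-2 g23's `…HomEntryFlipHcpKit` / `…HomEntryFlipHcp`,
which reduce the hcp half to `ξ₀ ≥ 0`, `ξ₂ ≥ 0` (×4) by the coordinate reflections `F₀`, `F₂`).  The stabiliser of an `A`-site of ideal hcp is `D₃ₕ` (order 12);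
besides `F₀`, `F₂` it is generated by the reflection `S` in the vertical plane with unit normal `n = h₁ = (1/2, √3/2, 0)`:
`S h₀ = h₀ − h₁`, `S h₁ = −h₁`, `S h₂ = h₂`, `S s = s − h₁` (`s = hcpShift`).  Hence the deformed structure of `(U, ξ)` and of the conjugate data
`(S U S, S ξ)` are CONGRUENT (relabel family `A` by the involution `mirLab (b₀,b₁,b₂) = (b₀, −b₀−b₁, b₂)`, family `B` by `shiftLabM b = mirLab b + (0,−1,0)`),
and the hcp dichotomy (prune ∨ floor) transfers exactly as for the flips; the tail argument (`W₄₅ = 0` beyond `9/2`; labels outside `[−7,7]³` are `≥ 6` resp.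
`≥ 25/4 − ‖ξ‖` long) is the one of the flip kit verbatim.  Part 4 (`…HomEntryMirrorHcp`) combines `S` with `F₀` (they generate `D₃` in the `(ξ₀, ξ₁)`-plane)
into the reduction to the 60° WEDGE `ξ₀ ≥ 0`, `3 ξ₁² ≤ ξ₀²` (×12 in all) — BUDGET-F (critic rows 1077/1083) shows this factor 3 is load-bearing for the hcp census.

* §1 `nvec`, ★ `mirIso` (Mathlib's reflection in `(ℝ ∙ n)ᗮ`), `mirIso_eq`, coordinates, `mirIso_symm`;
* §2 `mirLab`, `shiftLabM` (involutions), ★ `mirIso_hexPt` / `mirIso_hexPt_shift` (frame action), norm invariance;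
* §3 the conjugate `V = S U S`: `latPt V h b = S (latPt U h (mirLab b))`, `V (s + S ξ) = S (latPt U h ℓ + U (s + ξ))`;
* §4 the two box-sum identities `sumA (V) = sumA (U)`, `sumB (V, Sξ) = sumB (U, ξ)` (tail argument via `…FlipHcpKit.sum_comp_invol_eq`);
* §5 the realisation-set identity and ★★ `dichotomy_of_mirH`.

0 sorry; standard axioms; no instances / notation / `#eval`.  `--supports stmt-AtomisticToContinuum-27623`.
-/

namespace Summit.AtomisticToContinuum.Crystallization.Theorems.FrustratedLawDichotomyStrainedPatchHomEntryMirrorHcpKit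

open scoped BigOperators RealInnerProductSpace
open Literature.Analysis.ValidatedNumerics.Numerics
open Summit.AtomisticToContinuum.Crystallization.Theorems.ChargedEnergyGapNegative (E3)
open Summit.AtomisticToContinuum.Crystallization.Theorems.FrustratedLawDichotomySchurCut (effPot w₄₅ ω₄)
open Summit.AtomisticToContinuum.Crystallization.Theorems.FrustratedLawDichotomyAveragingRuleTightFree (TightNearCap BadNearCap)
open Summit.AtomisticToContinuum.Crystallization.Theorems.FrustratedLawDichotomyExemptAbsorption (ExemptNear)
open Summit.AtomisticToContinuum.Crystallization.Theorems.FrustratedLawDichotomyStrainedPatchHomSplit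
open Summit.AtomisticToContinuum.Crystallization.Theorems.FrustratedLawDichotomyStrainedPatchHomPolar
  (norm_apply_ge_of_norm_sub_one_le latPt_comp)
open Summit.AtomisticToContinuum.Crystallization.Theorems.FrustratedLawDichotomyStrainedPatchHomLattice (latPt_add)
open Summit.AtomisticToContinuum.Crystallization.Theorems.FrustratedLawDichotomyStrainedPatchHomLatticeBox (latPt_zero)
open Summit.AtomisticToContinuum.Crystallization.Theorems.FrustratedLawDichotomyStrainedPatchHomLatticeBoxHcp
  (latPt_eq_apply_one shifted_eq_apply mem_box_of_norm_hexPt_lt mem_box_of_norm_hexPt_add_shift_lt hexPt_apply_zero hexPt_apply_one hexPt_apply_two)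
open Summit.AtomisticToContinuum.Crystallization.Theorems.FrustratedLawDichotomyStrainedPatchHomIsometry (pruneHcp_comp)
open Summit.AtomisticToContinuum.Crystallization.Theorems.FrustratedLawDichotomyStrainedPatchHomTermCalculus (effPot45_eq_far)
open Summit.AtomisticToContinuum.Crystallization.Theorems.FrustratedLawDichotomyStrainedPatchHomEntryGramHcp (hcpShift_apply)
open Summit.AtomisticToContinuum.Crystallization.Theorems.FrustratedLawDichotomyStrainedPatchHomEntrySignKit
  (conjIso_apply conjIso_norm_sub_one_le)
open Summit.AtomisticToContinuum.Crystallization.Theorems.FrustratedLawDichotomyStrainedPatchHomEntryFlipHcpKit (sum_comp_invol_eq)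

/-! ## §1. The mirror `S` -/

/-- The unit normal `n = h₁ = (1/2, √3/2, 0)` of the mirror plane. -/
noncomputable def nvec : E3 := (1 / 2 : ℝ) • EuclideanSpace.single 0 (1 : ℝ) + (Real.sqrt 3 / 2) • EuclideanSpace.single 1 (1 : ℝ)

/-- Coordinates of `n`. [formal bookkeeping] -/
theorem nvec_apply (a : Fin 3) : nvec a = if a = 0 then (1 : ℝ) / 2 else if a = 1 then Real.sqrt 3 / 2 else 0 := by
  fin_cases a <;> simp [nvec]

/-- `⟪w, n⟫ = w₀/2 + (√3/2) w₁`. [formal bookkeeping] -/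
theorem inner_nvec (w : E3) : ⟪w, nvec⟫ = w 0 / 2 + Real.sqrt 3 / 2 * w 1 := by
  unfold nvec
  rw [inner_add_right, real_inner_smul_right, real_inner_smul_right, EuclideanSpace.inner_single_right, EuclideanSpace.inner_single_right]
  simp; ring

/-- `⟪n, n⟫ = 1` (`√3 · √3 = 3` is inlined everywhere: the one-liner exists far away in the tree). [formal bookkeeping] -/
theorem inner_nvec_self : ⟪nvec, nvec⟫ = (1 : ℝ) := by
  have h3 : Real.sqrt 3 * Real.sqrt 3 = 3 := Real.mul_self_sqrt (by norm_num)
  rw [inner_nvec, nvec_apply, nvec_apply]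
  simp
  linear_combination (1 / 4 : ℝ) * h3

/-- `S`: the reflection in the plane `(ℝ ∙ n)ᗮ` (a vertical mirror of the hcp `A`-site group). -/
noncomputable def mirIso : E3 ≃ₗᵢ[ℝ] E3 := ((ℝ ∙ nvec)ᗮ).reflection

/-- `S w = w − 2⟪w, n⟫ n`. [folklore] -/
theorem mirIso_eq (w : E3) : mirIso w = w - (2 * ⟪w, nvec⟫) • nvec := by
  have hmem : w - ⟪w, nvec⟫ • nvec ∈ (ℝ ∙ nvec)ᗮ := by
    rw [Submodule.mem_orthogonal_singleton_iff_inner_right, inner_sub_right, real_inner_smul_right, inner_nvec_self, real_inner_comm]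
    ring
  have hdec : w = (w - ⟪w, nvec⟫ • nvec) + ⟪w, nvec⟫ • nvec := (sub_add_cancel w _).symm
  unfold mirIso
  conv_lhs => rw [hdec]
  rw [map_add, map_smul, Submodule.reflection_mem_subspace_eq_self hmem, Submodule.reflection_orthogonalComplement_singleton_eq_neg]
  rw [smul_neg, two_mul, add_smul]
  abel

/-- Coordinates of `S w`: `(w₀/2 − (√3/2) w₁, −(√3/2) w₀ − w₁/2, w₂)`. [formal bookkeeping] -/
theorem mirIso_apply (w : E3) :
    mirIso w 0 = w 0 / 2 - Real.sqrt 3 / 2 * w 1 ∧ mirIso w 1 = -(Real.sqrt 3 / 2) * w 0 - w 1 / 2 ∧ mirIso w 2 = w 2 := by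
  have h3 : Real.sqrt 3 * Real.sqrt 3 = 3 := Real.mul_self_sqrt (by norm_num)
  refine ⟨?_, ?_, ?_⟩ <;> rw [mirIso_eq] <;> simp only [PiLp.sub_apply, PiLp.smul_apply, smul_eq_mul, inner_nvec, nvec_apply] <;> simp
  · ring
  · linear_combination (-(w 1) / 2) * h3

/-- `S⁻¹ = S`. [formal bookkeeping] -/
theorem mirIso_symm : mirIso.symm = mirIso := by
  unfold mirIso; exact Submodule.reflection_symm

/-- `S (S w) = w`. [formal bookkeeping] -/
theorem mirIso_mirIso (w : E3) : mirIso (mirIso w) = w := by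
  conv_lhs => rw [← mirIso_symm]
  exact mirIso.symm_apply_apply w

/-! ## §2. Labels and the frame action -/

/-- Relabelling of family `A` under `S`: `(b₀,b₁,b₂) ↦ (b₀, −b₀−b₁, b₂)`. -/
def mirLab (b : Fin 3 → ℤ) : Fin 3 → ℤ := ![b 0, -b 0 - b 1, b 2]

/-- Relabelling of family `B` under `S` (`mirLab` followed by the lattice shift `ℓ = (0,−1,0)` of `S s − s`). -/
def shiftLabM (b : Fin 3 → ℤ) : Fin 3 → ℤ := ![b 0, -b 0 - b 1 - 1, b 2]

/-- `mirLab` is an involution. [formal bookkeeping] -/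
theorem mirLab_mirLab (b : Fin 3 → ℤ) : mirLab (mirLab b) = b := by
  funext k
  unfold mirLab
  fin_cases k <;> simp

/-- `shiftLabM` is an involution. [formal bookkeeping] -/
theorem shiftLabM_shiftLabM (b : Fin 3 → ℤ) : shiftLabM (shiftLabM b) = b := by
  funext k
  unfold shiftLabM
  fin_cases k <;> simp; omega

/-- `shiftLabM b = mirLab b + shiftLabM 0`. [formal bookkeeping] -/
theorem shiftLabM_eq (b : Fin 3 → ℤ) : shiftLabM b = mirLab b + shiftLabM 0 := by
  funext k
  unfold shiftLabM mirLab
  (fin_cases k <;> simp); omega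

/-- `mirLab b = 0 ↔ b = 0`. [formal bookkeeping] -/
theorem mirLab_eq_zero_iff (b : Fin 3 → ℤ) : mirLab b = 0 ↔ b = 0 := by
  constructor
  · intro h
    have h0 := congrFun h 0; have h1 := congrFun h 1; have h2 := congrFun h 2
    simp [mirLab] at h0 h1 h2
    funext k; fin_cases k <;> simp <;> omega
  · intro h; rw [h]; unfold mirLab; funext k; fin_cases k <;> simp

/-- ★ **FRAME ACTION, family `A`**: `S (Σ_j b_j h_j) = Σ_k (mirLab b)_k h_k`. [folklore] -/
theorem mirIso_hexPt (b : Fin 3 → ℤ) : mirIso (latPt 1 hexFrame b) = latPt 1 hexFrame (mirLab b) := by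
  have h3 : Real.sqrt 3 * Real.sqrt 3 = 3 := Real.mul_self_sqrt (by norm_num)
  ext a
  obtain ⟨m0, m1, m2⟩ := mirIso_apply (latPt 1 hexFrame b)
  match a with
  | 0 =>
    rw [m0, hexPt_apply_zero, hexPt_apply_one, hexPt_apply_zero]
    simp [mirLab]
    linear_combination (-((b 1 : ℤ) : ℝ) / 4) * h3
  | 1 =>
    rw [m1, hexPt_apply_zero, hexPt_apply_one, hexPt_apply_one]
    simp [mirLab]
    ring
  | 2 =>
    rw [m2, hexPt_apply_two, hexPt_apply_two]
    simp [mirLab]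

/-- ★ **FRAME ACTION, family `B`**: `S (Σ_j b_j h_j + s) = Σ_k (shiftLabM b)_k h_k + s`. [folklore] -/
theorem mirIso_hexPt_shift (b : Fin 3 → ℤ) : mirIso (latPt 1 hexFrame b + hcpShift) = latPt 1 hexFrame (shiftLabM b) + hcpShift := by
  have h3 : Real.sqrt 3 * Real.sqrt 3 = 3 := Real.mul_self_sqrt (by norm_num)
  ext a
  obtain ⟨m0, m1, m2⟩ := mirIso_apply (latPt 1 hexFrame b + hcpShift)
  match a with
  | 0 =>
    rw [m0]
    simp only [PiLp.add_apply]
    rw [hexPt_apply_zero, hexPt_apply_one, hexPt_apply_zero, hcpShift_apply, hcpShift_apply]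
    simp [shiftLabM]
    linear_combination (-((b 1 : ℤ) : ℝ) / 4 - 1 / 12) * h3
  | 1 =>
    rw [m1]
    simp only [PiLp.add_apply]
    rw [hexPt_apply_zero, hexPt_apply_one, hexPt_apply_one, hcpShift_apply, hcpShift_apply]
    simp [shiftLabM]
    ring
  | 2 =>
    rw [m2]
    simp only [PiLp.add_apply]
    rw [hexPt_apply_two, hexPt_apply_two]
    simp [shiftLabM]

/-- `S s = latPt 1 h ℓ + s` (`ℓ = shiftLabM 0 = (0,−1,0)`). [formal bookkeeping] -/
theorem mirIso_hcpShift : mirIso hcpShift = latPt 1 hexFrame (shiftLabM 0) + hcpShift := by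
  have := mirIso_hexPt_shift 0
  rwa [latPt_zero, zero_add] at this

/-- Norm invariance of family-`A` labels under the relabelling. [formal bookkeeping] -/
theorem norm_hexPt_mirLab (b : Fin 3 → ℤ) : ‖latPt 1 hexFrame (mirLab b)‖ = ‖latPt 1 hexFrame b‖ := by
  rw [← mirIso_hexPt, LinearIsometryEquiv.norm_map]

/-- Norm invariance of family-`B` labels under the relabelling. [formal bookkeeping] -/
theorem norm_hexPt_shift_shiftLabM (b : Fin 3 → ℤ) : ‖latPt 1 hexFrame (shiftLabM b) + hcpShift‖ = ‖latPt 1 hexFrame b + hcpShift‖ := by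
  rw [← mirIso_hexPt_shift, LinearIsometryEquiv.norm_map]

/-! ## §3. The conjugate data `(S U S, S ξ)` -/

/-- ★ `latPt (S U S) h b = S (latPt U h (mirLab b))`. [folklore] -/
theorem latPt_conjM (U : E3 →L[ℝ] E3) (b : Fin 3 → ℤ) :
    latPt ((mirIso : E3 →L[ℝ] E3).comp (U.comp (mirIso.symm : E3 →L[ℝ] E3))) hexFrame b = mirIso (latPt U hexFrame (mirLab b)) := by
  rw [latPt_eq_apply_one, conjIso_apply, mirIso_symm, mirIso_hexPt, ← latPt_eq_apply_one]

/-- ★ `(S U S) (s + S ξ) = S (latPt U h ℓ + U (s + ξ))`. [folklore] -/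
theorem conj_shiftM (U : E3 →L[ℝ] E3) (ξ : E3) :
    ((mirIso : E3 →L[ℝ] E3).comp (U.comp (mirIso.symm : E3 →L[ℝ] E3))) (hcpShift + mirIso ξ) =
      mirIso (latPt U hexFrame (shiftLabM 0) + U (hcpShift + ξ)) := by
  rw [conjIso_apply, mirIso_symm, map_add, mirIso_mirIso, mirIso_hcpShift, latPt_eq_apply_one U, ← map_add, add_assoc]

/-- The conjugate's summand of family `B`: `latPt V h b + V (s + Sξ) = S (latPt U h (shiftLabM b) + U (s + ξ))`. [folklore] -/
theorem conj_shifted_pointM (U : E3 →L[ℝ] E3) (ξ : E3) (b : Fin 3 → ℤ) :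
    latPt ((mirIso : E3 →L[ℝ] E3).comp (U.comp (mirIso.symm : E3 →L[ℝ] E3))) hexFrame b +
        ((mirIso : E3 →L[ℝ] E3).comp (U.comp (mirIso.symm : E3 →L[ℝ] E3))) (hcpShift + mirIso ξ) =
      mirIso (latPt U hexFrame (shiftLabM b) + U (hcpShift + ξ)) := by
  rw [latPt_conjM, conj_shiftM, ← map_add, shiftLabM_eq b, latPt_add]
  congr 1
  abel

/-! ## §4. The two box sums -/

/-- ★ **BOX SUM OF FAMILY `A` IS MIRROR-INVARIANT** (tail argument: labels outside `[−7,7]³` are `≥ 6` long, `W₄₅ = 0` beyond `9/2`). [folklore] -/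
theorem boxSumA_mir (U : E3 →L[ℝ] E3) (hU : ‖U - 1‖ ≤ 1 / 4) :
    ∑ b ∈ (Fintype.piFinset fun _ : Fin 3 => Finset.Icc (-7 : ℤ) 7).filter (fun b => b ≠ 0),
        effPot w₄₅ ω₄ (3 / 400) ‖latPt ((mirIso : E3 →L[ℝ] E3).comp (U.comp (mirIso.symm : E3 →L[ℝ] E3))) hexFrame b‖ =
      ∑ b ∈ (Fintype.piFinset fun _ : Fin 3 => Finset.Icc (-7 : ℤ) 7).filter (fun b => b ≠ 0), effPot w₄₅ ω₄ (3 / 400) ‖latPt U hexFrame b‖ := by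
  classical
  have far : ∀ b : Fin 3 → ℤ, b ∉ (Fintype.piFinset fun _ : Fin 3 => Finset.Icc (-7 : ℤ) 7) → effPot w₄₅ ω₄ (3 / 400) ‖latPt U hexFrame b‖ = 0 := by
    intro b hb
    have h6 : (6 : ℝ) ≤ ‖latPt 1 hexFrame b‖ := not_lt.1 fun h => hb (mem_box_of_norm_hexPt_lt h)
    have h34 := norm_apply_ge_of_norm_sub_one_le hU (latPt 1 hexFrame b)
    rw [← latPt_eq_apply_one] at h34
    exact effPot45_eq_far (by linarith)
  have e1 : ∀ b, effPot w₄₅ ω₄ (3 / 400) ‖latPt ((mirIso : E3 →L[ℝ] E3).comp (U.comp (mirIso.symm : E3 →L[ℝ] E3))) hexFrame b‖ =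
      effPot w₄₅ ω₄ (3 / 400) ‖latPt U hexFrame (mirLab b)‖ := fun b => by rw [latPt_conjM, LinearIsometryEquiv.norm_map]
  rw [Finset.sum_congr rfl fun b _ => e1 b]
  refine sum_comp_invol_eq (φ := mirLab) (F := fun b => effPot w₄₅ ω₄ (3 / 400) ‖latPt U hexFrame b‖) mirLab_mirLab
    (fun b hb hφ => ?_) (fun b hb hφ => ?_)
  · have hb0 : b ≠ 0 := (Finset.mem_filter.1 hb).2
    have hφ' : mirLab b ∉ (Fintype.piFinset fun _ : Fin 3 => Finset.Icc (-7 : ℤ) 7) := fun h =>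
      hφ (Finset.mem_filter.2 ⟨h, fun h0 => hb0 ((mirLab_eq_zero_iff b).1 h0)⟩)
    exact far _ hφ'
  · have hb0 : b ≠ 0 := (Finset.mem_filter.1 hb).2
    have hφ' : mirLab b ∉ (Fintype.piFinset fun _ : Fin 3 => Finset.Icc (-7 : ℤ) 7) := fun h =>
      hφ (Finset.mem_filter.2 ⟨h, fun h0 => hb0 ((mirLab_eq_zero_iff b).1 h0)⟩)
    have h6 : (6 : ℝ) ≤ ‖latPt 1 hexFrame b‖ := by
      rw [← norm_hexPt_mirLab]
      exact not_lt.1 fun h => hφ' (mem_box_of_norm_hexPt_lt h)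
    have h34 := norm_apply_ge_of_norm_sub_one_le hU (latPt 1 hexFrame b)
    rw [← latPt_eq_apply_one] at h34
    exact effPot45_eq_far (by linarith)

/-- ★ **BOX SUM OF FAMILY `B` IS MIRROR-INVARIANT** (tail: labels outside `[−7,7]³` are `≥ 25/4 − ‖ξ‖` long after the shift). [folklore] -/
theorem boxSumB_mir (U : E3 →L[ℝ] E3) (ξ : E3) (hU : ‖U - 1‖ ≤ 1 / 4) (hξ : ‖ξ‖ ≤ 1 / 4) :
    ∑ b ∈ (Fintype.piFinset fun _ : Fin 3 => Finset.Icc (-7 : ℤ) 7),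
        effPot w₄₅ ω₄ (3 / 400) ‖latPt ((mirIso : E3 →L[ℝ] E3).comp (U.comp (mirIso.symm : E3 →L[ℝ] E3))) hexFrame b +
          ((mirIso : E3 →L[ℝ] E3).comp (U.comp (mirIso.symm : E3 →L[ℝ] E3))) (hcpShift + mirIso ξ)‖ =
      ∑ b ∈ (Fintype.piFinset fun _ : Fin 3 => Finset.Icc (-7 : ℤ) 7), effPot w₄₅ ω₄ (3 / 400) ‖latPt U hexFrame b + U (hcpShift + ξ)‖ := by
  classical
  have farN : ∀ b : Fin 3 → ℤ, (25 : ℝ) / 4 ≤ ‖latPt 1 hexFrame b + hcpShift‖ → effPot w₄₅ ω₄ (3 / 400) ‖latPt U hexFrame b + U (hcpShift + ξ)‖ = 0 := by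
    intro b h6
    have h34 := norm_apply_ge_of_norm_sub_one_le hU (latPt 1 hexFrame b + hcpShift + ξ)
    rw [← shifted_eq_apply] at h34
    have htri : ‖latPt 1 hexFrame b + hcpShift‖ - ‖ξ‖ ≤ ‖latPt 1 hexFrame b + hcpShift + ξ‖ := by
      have := norm_sub_le (latPt 1 hexFrame b + hcpShift + ξ) ξ
      rw [add_sub_cancel_right] at this
      linarith
    exact effPot45_eq_far (by nlinarith)
  have far : ∀ b : Fin 3 → ℤ, b ∉ (Fintype.piFinset fun _ : Fin 3 => Finset.Icc (-7 : ℤ) 7) →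
      effPot w₄₅ ω₄ (3 / 400) ‖latPt U hexFrame b + U (hcpShift + ξ)‖ = 0 := fun b hb =>
    farN b (not_lt.1 fun h => hb (mem_box_of_norm_hexPt_add_shift_lt h))
  have e1 : ∀ b, effPot w₄₅ ω₄ (3 / 400) ‖latPt ((mirIso : E3 →L[ℝ] E3).comp (U.comp (mirIso.symm : E3 →L[ℝ] E3))) hexFrame b +
      ((mirIso : E3 →L[ℝ] E3).comp (U.comp (mirIso.symm : E3 →L[ℝ] E3))) (hcpShift + mirIso ξ)‖ =
      effPot w₄₅ ω₄ (3 / 400) ‖latPt U hexFrame (shiftLabM b) + U (hcpShift + ξ)‖ := fun b => by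
    rw [conj_shifted_pointM, LinearIsometryEquiv.norm_map]
  rw [Finset.sum_congr rfl fun b _ => e1 b]
  refine sum_comp_invol_eq (φ := shiftLabM) (F := fun b => effPot w₄₅ ω₄ (3 / 400) ‖latPt U hexFrame b + U (hcpShift + ξ)‖)
    shiftLabM_shiftLabM (fun b _ hφ => far _ hφ) (fun b _ hφ => ?_)
  have h6 : (25 : ℝ) / 4 ≤ ‖latPt 1 hexFrame b + hcpShift‖ := by
    rw [← norm_hexPt_shift_shiftLabM]
    exact not_lt.1 fun h => hφ (mem_box_of_norm_hexPt_add_shift_lt h)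
  exact farN b h6

/-! ## §5. The realisation set and the transfer of the dichotomy -/

/-- The realisation set of the `(U, ξ)`-hcp ball equals that of the `(S⁻¹ ∘ V, s + S ξ)` data, `V = S U S` (relabel the two families by the
involutions `mirLab`, `shiftLabM`). [folklore] -/
theorem range_set_eq_mirH (U : E3 →L[ℝ] E3) (ξ : E3) (ϱ : ℝ) (x0 : E3) :
    {x : E3 | dist x x0 ≤ ϱ ∧ ∃ a : Fin 3 → ℤ, x = x0 + latPt U hexFrame a ∨ x = x0 + latPt U hexFrame a + U (hcpShift + ξ)} =
      {x : E3 | dist x x0 ≤ ϱ ∧ ∃ a : Fin 3 → ℤ,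
        x = x0 + latPt (((mirIso.symm : E3 ≃ₗᵢ[ℝ] E3) : E3 →L[ℝ] E3).comp
          ((mirIso : E3 →L[ℝ] E3).comp (U.comp (mirIso.symm : E3 →L[ℝ] E3)))) hexFrame a ∨
        x = x0 + latPt (((mirIso.symm : E3 ≃ₗᵢ[ℝ] E3) : E3 →L[ℝ] E3).comp
          ((mirIso : E3 →L[ℝ] E3).comp (U.comp (mirIso.symm : E3 →L[ℝ] E3)))) hexFrame a +
          (((mirIso.symm : E3 ≃ₗᵢ[ℝ] E3) : E3 →L[ℝ] E3).comp
            ((mirIso : E3 →L[ℝ] E3).comp (U.comp (mirIso.symm : E3 →L[ℝ] E3)))) (hcpShift + mirIso ξ)} := by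
  have eA : ∀ a, latPt (((mirIso.symm : E3 ≃ₗᵢ[ℝ] E3) : E3 →L[ℝ] E3).comp
      ((mirIso : E3 →L[ℝ] E3).comp (U.comp (mirIso.symm : E3 →L[ℝ] E3)))) hexFrame a = latPt U hexFrame (mirLab a) := fun a => by
    rw [latPt_comp, latPt_conjM, LinearIsometryEquiv.symm_apply_apply]
  have eB : (((mirIso.symm : E3 ≃ₗᵢ[ℝ] E3) : E3 →L[ℝ] E3).comp
      ((mirIso : E3 →L[ℝ] E3).comp (U.comp (mirIso.symm : E3 →L[ℝ] E3)))) (hcpShift + mirIso ξ) =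
      latPt U hexFrame (shiftLabM 0) + U (hcpShift + ξ) := by
    rw [ContinuousLinearMap.comp_apply, conj_shiftM]
    exact mirIso.symm_apply_apply _
  ext x
  simp only [Set.mem_setOf_eq]
  refine and_congr_right fun _ => ⟨?_, ?_⟩
  · rintro ⟨a, ha | ha⟩
    · exact ⟨mirLab a, Or.inl (by rw [eA, mirLab_mirLab]; exact ha)⟩
    · refine ⟨shiftLabM a, Or.inr ?_⟩
      have key : latPt U hexFrame (mirLab (shiftLabM a)) + latPt U hexFrame (shiftLabM 0) = latPt U hexFrame a := by
        rw [← latPt_add, ← shiftLabM_eq, shiftLabM_shiftLabM]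
      rw [eA, eB, ha, ← key]
      abel
  · rintro ⟨a, ha | ha⟩
    · exact ⟨mirLab a, Or.inl (by rw [eA] at ha; exact ha)⟩
    · refine ⟨shiftLabM a, Or.inr ?_⟩
      have key : latPt U hexFrame (mirLab a) + latPt U hexFrame (shiftLabM 0) = latPt U hexFrame (shiftLabM a) := by
        rw [← latPt_add, ← shiftLabM_eq]
      rw [eA, eB] at ha
      rw [ha, ← key]
      abel

/-- ★★ **TRANSFER**: the hcp dichotomy (prune ∨ `m`-floor) for the conjugate data `(S U S, S ξ)` gives it for `(U, ξ)` (`‖U − 1‖ ≤ 1/4`, `‖ξ‖ ≤ 1/4`).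
[folklore] -/
theorem dichotomy_of_mirH (U : E3 →L[ℝ] E3) (ξ : E3) (hU : ‖U - 1‖ ≤ 1 / 4) (hξ : ‖ξ‖ ≤ 1 / 4) {m : ℝ}
    (h : (∀ (M : ℕ) (z : Fin M → E3) (c : Fin M), Function.Injective z →
        Set.range z = {x : E3 | dist x (z c) ≤ 133 / 10 ∧ ∃ a : Fin 3 → ℤ,
          x = z c + latPt ((mirIso : E3 →L[ℝ] E3).comp (U.comp (mirIso.symm : E3 →L[ℝ] E3))) hexFrame a ∨
          x = z c + latPt ((mirIso : E3 →L[ℝ] E3).comp (U.comp (mirIso.symm : E3 →L[ℝ] E3))) hexFrame a +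
            ((mirIso : E3 →L[ℝ] E3).comp (U.comp (mirIso.symm : E3 →L[ℝ] E3))) (hcpShift + mirIso ξ)} →
        TightNearCap (9 / 5) (3 / 2) z c ∨ ExemptNear (9 / 5) ExRec z c ∨ BadNearCap (9 / 5) (3 / 2) z c) ∨
      m ≤ (∑ b ∈ (Fintype.piFinset fun _ : Fin 3 => Finset.Icc (-7 : ℤ) 7).filter (fun b => b ≠ 0),
          effPot w₄₅ ω₄ (3 / 400) ‖latPt ((mirIso : E3 →L[ℝ] E3).comp (U.comp (mirIso.symm : E3 →L[ℝ] E3))) hexFrame b‖ +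
        ∑ b ∈ (Fintype.piFinset fun _ : Fin 3 => Finset.Icc (-7 : ℤ) 7),
          effPot w₄₅ ω₄ (3 / 400) ‖latPt ((mirIso : E3 →L[ℝ] E3).comp (U.comp (mirIso.symm : E3 →L[ℝ] E3))) hexFrame b +
            ((mirIso : E3 →L[ℝ] E3).comp (U.comp (mirIso.symm : E3 →L[ℝ] E3))) (hcpShift + mirIso ξ)‖) / 2 -
        (-(7175 / 10000) + 3 / 400)) :
    (∀ (M : ℕ) (z : Fin M → E3) (c : Fin M), Function.Injective z →
        Set.range z = {x : E3 | dist x (z c) ≤ 133 / 10 ∧ ∃ a : Fin 3 → ℤ,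
          x = z c + latPt U hexFrame a ∨ x = z c + latPt U hexFrame a + U (hcpShift + ξ)} →
        TightNearCap (9 / 5) (3 / 2) z c ∨ ExemptNear (9 / 5) ExRec z c ∨ BadNearCap (9 / 5) (3 / 2) z c) ∨
      m ≤ (∑ b ∈ (Fintype.piFinset fun _ : Fin 3 => Finset.Icc (-7 : ℤ) 7).filter (fun b => b ≠ 0),
          effPot w₄₅ ω₄ (3 / 400) ‖latPt U hexFrame b‖ +
        ∑ b ∈ (Fintype.piFinset fun _ : Fin 3 => Finset.Icc (-7 : ℤ) 7),
          effPot w₄₅ ω₄ (3 / 400) ‖latPt U hexFrame b + U (hcpShift + ξ)‖) / 2 - (-(7175 / 10000) + 3 / 400) := by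
  rcases h with h | h
  · left
    intro M z c hz hrange
    rw [range_set_eq_mirH U ξ (133 / 10) (z c)] at hrange
    exact pruneHcp_comp mirIso.symm _ hexFrame (hcpShift + mirIso ξ) (133 / 10) h M z c hz hrange
  · right; rwa [boxSumA_mir U hU, boxSumB_mir U ξ hU hξ] at h

end Summit.AtomisticToContinuum.Crystallization.Theorems.FrustratedLawDichotomyStrainedPatchHomEntryMirrorHcpKit
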